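import Summits.ResolutionOfSingularities.ResolutionOfSingularities.Theses.TropicalLinks
import Summits.ResolutionOfSingularities.ResolutionOfSingularities.Theorems.DescentAlgclosedToPerfect.Negative.AntecedentNonVacuity

/-!
# `SchonResolves` (crux stmt-ResolutionOfSingularities-17234, route `TropicalLinks`):
# summit-safety and the load-bearing `IsIntegral X`
# (negative-side support, refuter cdisprove seat; this file does NOT refute the crux)

The crux is definitionally `∀ p prime, H p → C p` with `H p` the route's typed Tevelev conjecture in
characteristic `p` (all dimensions) and `C p` = weak resolution of INTEGRAL separated finite-type
schemes over ALGEBRAICALLY CLOSED fields of characteristic `p`. Three sorry-free, definition-free facts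
(statements written inline) recorded for planners and provers:

* `not_resolutionOfSingularities_of_not_schonResolves` — **any refutation of the crux refutes the
  summit**: `¬ SchonResolves` yields a prime `p` with `H p ∧ ¬ C p`, and `C p` is an instance of
  `ResolutionInChar p` (integral ⇒ reduced). So no `_false_without_` lemma keeping the schön
  antecedent can exist for any hypothesis of this crux unless resolution in positive characteristic
  fails; the disprover's cheap attacks are structurally exhausted (see
  `Cruxes/SchonResolves/Disproof.lean` for the full record, incl. the characteristic-free audit of
  Tevelev 2007 / Luxton–Qu 2011 with page citations).
* `conclusion_false_without_locallyOfFiniteType` — **finite type cannot be deleted from the consequent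
  block** (even keeping integrality): witness `Spec k̄[X]⁺ → Spec k̄`, `k̄ = AlgebraicClosure 𝔽_p`
  (absolute integral closure of the affine line: affine, integral, every non-generic stalk
  non-Noetherian), via the Descent disprover's
  `DescentAlgclosedToPerfect.Negative.not_hasResolution_spec_absoluteIntegralClosure`.
* `schonResolves_without_isIntegral_imp_not_hyp` — **`IsIntegral X` (indeed reducedness) cannot be
  deleted from the consequent block**: that block is VERBATIM the antecedent of the shared Descent
  crux without `IsReduced`, refuted at every prime by `Spec k̄[ε]`
  (`DescentAlgclosedToPerfect.Negative.antecedent_false_without_isReduced`, reused, not restated);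
  consequently the crux with `IsIntegral X` deleted holds at `p` only if `H p` fails — it degenerates
  into the prime-by-prime negation of the route's own target `SchonPlus`.

Moral for provers: integrality enters the intended proof exactly where it must (a dense very affine
open `U ⊆ X`, and `IsBirational` over `U[G⁻¹]`); every other hypothesis is used by the PLAN
(separatedness for properness of `Ū' → X`, quasi-compactness for `X ↪ ℙ^M`, finite type for
Noetherian stalks) but none is refutably necessary.
-/

noncomputable section

-- single-problem summit: the doubled namespace component `ResolutionOfSingularities` is forced
set_option linter.dupNamespace false

namespace Summit.ResolutionOfSingularities.ResolutionOfSingularities.Theorems.SchonResolves.Negative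

open CategoryTheory AlgebraicGeometry
open Literature.AlgebraicGeometry.Resolution
open Summit.ResolutionOfSingularities.ResolutionOfSingularities.Theses.TropicalLinks

/-- **Any refutation of `SchonResolves` refutes the summit `ResolutionOfSingularities`.** From
`¬ (∀ p prime, H p → C p)` extract a prime `p` with `¬ C p`; but the summit gives `ResolutionInChar p`,
whose specialisation to integral `X` over an algebraically closed field is `C p` (integral schemes are
reduced). The schön antecedent is discarded. [folklore] -/
theorem not_resolutionOfSingularities_of_not_schonResolves (h : ¬ SchonResolves) :
    ¬ _root_.ResolutionOfSingularities := by
  intro hR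
  apply h
  intro p hp _ k _ _ _ X f hs hl hq hint
  exact _root_.ResolutionOfSingularities_iff.mp hR p hp k X f hs hl hq inferInstance

/-- **The consequent block of `SchonResolves` with `LocallyOfFiniteType f` deleted is false for every
prime `p`** (even keeping `IsIntegral X`): witness `Spec k̄[X]⁺ → Spec k̄`, the absolute integral
closure of the affine line over `k̄ = AlgebraicClosure (ZMod p)` — affine (separated, quasi-compact),
the spectrum of a domain (integral), without resolution because every non-generic stalk of a
square-root-closed domain is non-Noetherian
(`DescentAlgclosedToPerfect.Negative.not_hasResolution_spec_absoluteIntegralClosure`, run over an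
arbitrary ground field by the Descent disprover). The block with `IsIntegral X` deleted instead is
refuted verbatim by `DescentAlgclosedToPerfect.Negative.antecedent_false_without_isReduced`
(witness `Spec k̄[ε]`), reused below. [folklore] -/
theorem conclusion_false_without_locallyOfFiniteType (p : ℕ) [Fact p.Prime] :
    ¬ ∀ (k : Type) [Field k] [CharP k p] [IsAlgClosed k] (X : Scheme.{0}) (f : X ⟶ Spec (.of k)),
      IsSeparated f → QuasiCompact f → IsIntegral X → Scheme.HasResolution X := by
  intro h
  let K : Type := AlgebraicClosure (ZMod p)
  let R : Type := ↥(integralClosure (Polynomial K) (AlgebraicClosure (RatFunc K)))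
  let f : Spec (.of R) ⟶ Spec (.of K) :=
    Spec.map (CommRingCat.ofHom ((algebraMap (Polynomial K) R).comp Polynomial.C))
  haveI : IsIntegral (Spec (.of R)) := inferInstance
  exact DescentAlgclosedToPerfect.Negative.not_hasResolution_spec_absoluteIntegralClosure K
    (h K (Spec (.of R)) f inferInstance inferInstance inferInstance)

/-- **Deleting `IsIntegral X` degenerates the crux into the negation of its own antecedent**: if, at a
prime `p`, the typed Tevelev conjecture (the antecedent of `SchonResolves`, inlined verbatim) implied
the consequent block WITHOUT `IsIntegral X`, then the typed Tevelev conjecture would fail at `p`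
(by `DescentAlgclosedToPerfect.Negative.antecedent_false_without_isReduced`, the `Spec k̄[ε]`
witness landed for the shared Descent crux, whose antecedent is this crux's consequent block without
`IsIntegral`). [folklore] -/
theorem schonResolves_without_isIntegral_imp_not_hyp {p : ℕ} (hp : p.Prime)
    (h : (∀ d : ℕ, (fun (p d : ℕ) => ∀ (k : Type) [Field k] [CharP k p] [IsAlgClosed k] (N : ℕ) (I : Ideal (AddMonoidAlgebra k (Fin N → ℤ))), I.IsPrime → ringKrullDim (AddMonoidAlgebra k (Fin N → ℤ) ⧸ I) = (d : WithBot ℕ∞) → ∃ (m : ℕ) (G : Fin m → AddMonoidAlgebra k (Fin N → ℤ)), (∀ j, G j ∉ I) ∧ ∀ (w : Fin (N + m) → ℤ) (P : Ideal (AddMonoidAlgebra k (Fin (N + m) → ℤ) ⧸ Ideal.span ((fun f : AddMonoidAlgebra k (Fin (N + m) → ℤ) => AddMonoidAlgebra.ofCoeff (f.coeff.filter fun v => ∀ u ∈ f.coeff.support, ∑ i, w i * v i ≤ ∑ i, w i * u i)) '' (↑(Ideal.span ((fun f : AddMonoidAlgebra k (Fin N → ℤ) => (AddMonoidAlgebra.ofCoeff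 (f.coeff.mapDomain fun v => Fin.append v (0 : Fin m → ℤ)) : AddMonoidAlgebra k (Fin (N + m) → ℤ))) '' (↑I : Set (AddMonoidAlgebra k (Fin N → ℤ))) ∪ Set.range (fun j : Fin m => AddMonoidAlgebra.single (Fin.append (0 : Fin N → ℤ) (Pi.single j (1 : ℤ))) (1 : k) - AddMonoidAlgebra.ofCoeff ((G j).coeff.mapDomain fun v => Fin.append v (0 : Fin m → ℤ))))) : Set (AddMonoidAlgebra k (Fin (N + m) → ℤ)))))) [P.IsPrime], IsRegularLocalRing (Localization.AtPrime P)) p d) →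
      ∀ (k : Type) [Field k] [CharP k p] [IsAlgClosed k] (X : Scheme.{0}) (f : X ⟶ Spec (.of k)),
        IsSeparated f → LocallyOfFiniteType f → QuasiCompact f → Scheme.HasResolution X) :
    ¬ ∀ d : ℕ, (fun (p d : ℕ) => ∀ (k : Type) [Field k] [CharP k p] [IsAlgClosed k] (N : ℕ) (I : Ideal (AddMonoidAlgebra k (Fin N → ℤ))), I.IsPrime → ringKrullDim (AddMonoidAlgebra k (Fin N → ℤ) ⧸ I) = (d : WithBot ℕ∞) → ∃ (m : ℕ) (G : Fin m → AddMonoidAlgebra k (Fin N → ℤ)), (∀ j, G j ∉ I) ∧ ∀ (w : Fin (N + m) → ℤ) (P : Ideal (AddMonoidAlgebra k (Fin (N + m) → ℤ) ⧸ Ideal.span ((fun f : AddMonoidAlgebra k (Fin (N + m) → ℤ) => AddMonoidAlgebra.ofCoeff (f.coeff.filter fun v => ∀ u ∈ f.coeff.support, ∑ i, w i * v i ≤ ∑ i, w i * u i)) '' (↑(Ideal.span ((fun f : AddMonoidAlgebra k (Fin N → ℤ) => (AddMonoidAlgebra.ofCoeff (f.coeff.mapDomain fun v => Fin.append v (0 :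 Fin m → ℤ)) : AddMonoidAlgebra k (Fin (N + m) → ℤ))) '' (↑I : Set (AddMonoidAlgebra k (Fin N → ℤ))) ∪ Set.range (fun j : Fin m => AddMonoidAlgebra.single (Fin.append (0 : Fin N → ℤ) (Pi.single j (1 : ℤ))) (1 : k) - AddMonoidAlgebra.ofCoeff ((G j).coeff.mapDomain fun v => Fin.append v (0 : Fin m → ℤ))))) : Set (AddMonoidAlgebra k (Fin (N + m) → ℤ)))))) [P.IsPrime], IsRegularLocalRing (Localization.AtPrime P)) p d := by
  intro hH
  haveI : Fact p.Prime := ⟨hp⟩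
  exact DescentAlgclosedToPerfect.Negative.antecedent_false_without_isReduced p (h hH)

end Summit.ResolutionOfSingularities.ResolutionOfSingularities.Theorems.SchonResolves.Negative

end
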